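import Summits.QuantumFields.BalabanUV.T4Continuum.Support.B13ReadingsImage
import Summits.QuantumFields.BalabanUV.T4Continuum.Support.B13ReadingsDecay
import Summits.QuantumFields.BalabanUV.T4Continuum.Support.ColourPerturbedStations

/-!
# B13ReadingsDelta — row O4-r: THE Δ SPECIES (`deltaKer`, `gammaConstituent`) OF RECORD AT BAŁABAN's TIER-B BACKGROUND, RATE-GENERIC:
# the operator-norm two-level rate of the member of record, King's shape for its operator-Lipschitz images, the two species faces and the
# inverse-dictionary face (file 2 of 3 of the (M1-Δ) item of the NE5 verdict sheet §9; file 1 = `B13ReadingsImage`, generic; file 3 =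
# `B13ReadingsAssembly`, the five species conjuncts assembled into the END-of-record W1 binder `hwer`)

Cell `pub-balaban`, unit `b2b-balaban-t4-ne5-p1` (row NE5 OWNER, gen 34; owner item «g34-a»).  Summits-side NEW WORK under the LEAN
PLACEMENT RULE (compositions of landed theorems BY NAME; print cited for KIND only).  HONEST FRAMING: rung (B)+1 of the FINITE-VOLUME
T⁴ continuum programme — NOT infinite volume, NOT a mass gap, NOT the Clay problem, NOT a proof of NE5 (NOT PRINTED: the series prints
ε-UNIFORM bounds, never η-RATES; GAPS G-t4-U3-1), NOT a proof of NE2 or NE3.  HONEST DEPENDENCY (cell, verbatim): continuum YM on T⁴ ⇐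
BetaPertH ∧ nine spine estimates (0/9 proved); BetaPertH ⇐ (D1) ∧ (D4) ∧ CAP+tail; G-an2-4 gates asym, D1 and NE2/3/4.

CONTENTS (the member of record is `c_k(V) = pertCovC (P_B(Rg V)) 1 k`, row NE2's model of Bałaban's averaged background covariance on
the unit lattice, `Spine/NE2ColourPerturbedLayer`; the readings are `B13ReadingsImage`'s):
§1 **`balaban_twoLevelOpRate_rate`** — THE OPERATOR-NORM TWO-LEVEL RATE `‖c_{k+1} − c_k‖ ≤ Cpert·ρ^k` (`d ≥ 1`, `L⁻¹ ≤ ρ < 1`; PART 4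
   `NE2BalabanFinalRate.perturbationLaws_balaban_final_rate` ∘ leaf-08's one-step station `ColourPerturbedStations.opNorm_pertCovC_succ_sub_le`
   ∘ `BackgroundResolventTower.Epert_le_Cpert`; ⇐ NE3 `LocalRate … C ρ` (OPEN, displayed) ∧ the (3.35)-class ∧ the threshold `α, β ≤ η ≤ etaStar`)
   — the rate-generic tier-B instance of `opNorm_pertCovC_succ_sub_le_geom`, sharper than the two-level bound read off the limit rate; and
   **`balaban_image_twoLevelDecayRate_rate`** — for slot-indexed readings `Φ t`, `Λ`-Lipschitz in operator norm on a set `S` holding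
   every level of every member (`hS`), and ONE displayed level-uniform decay binder `hdecΦ` on the images (the printed KIND — η-uniform
   exponential decay of Bałaban's kernels, [Balaban1985BackgroundPropagators] Thm 3.4 p. 400 — asserted by nobody): King's (4.38) two-level
   shape for the images with `(√(2B·Λ·Cpert), δ∕2, √ρ)`.
§2 the species faces **`deltaKer_entryBound_balaban_rate`**, **`gammaConstituent_entryBound_balaban_rate`** (the `SpeciesEntryBound`
   conjuncts of W1 OF RECORD for the two Δ species — slots `h₂`, `h₃` of `B13ReadingsLocal.speciesEntryBound_of_rates` — at the input rate
   `√ρ < 1`, NO `1 ∕ min wt` loss), the INVERSE-dictionary face **`deltaKer_entryBound_balaban_inv_rate`** (`Φ t = R t ∘ inverse` with ONE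
   displayed UNIFORM COERCIVITY binder `hco : ∀ V k, Coercive γ (c_k(V))` — a uniform LOWER bound on the covariance member, i.e. an UPPER
   bound on the `δ`-function operator of the KIND of [Balaban1984PropagatorsI] (1.67) p. 29 «⟨B, Δ_kB⟩ ≦ γ₁⟨∂₁B, ∂₁B⟩», asserted by
   nobody; constant `√(2B·Λγ⁻²·Cpert)`), and the twin on node NE3's carrier **`deltaKer_entryBound_balaban_ne3Shape`** (ONE binder
   `NE3Shape (minActReadings …) C θ`, rate `√(max θ L⁻¹)`; the `gammaConstituent` twin is the same substitution).
So AT THE END OF RECORD (M1) is TYPED AND COMPOSED FOR ALL FIVE SPECIES modulo: NE3 (OPEN), the class, the threshold, and DISPLAYED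
readings ∕ decay ∕ coercivity binders whose instance on Bałaban's concrete (2.14) data is the substrate's O1 (Q-NE9-O1; WHICH `Φ t`
realises `A` and `L` is the O-8 dictionary — model level, not asserted); the assembly of the five conjuncts into `hwer` is file 3.  Rows NE2's
ROOT B ∕ PART 4 are consumed BY NAME — nothing of NE2 TYPE displayed.  VALUE UNCHANGED: NE5 NOT PRINTED ∕ NOT PROVED; 0∕12 leaves on Bałaban's concrete objects; spine 0∕9.
`FlowStep.BetaPertH`, (B), (B^μ) do not occur.  ABSOLUTE RULE kept; 0 def; 0 sorry.
-/

noncomputable section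

open scoped BigOperators ComplexConjugate Matrix Matrix.Norms.L2Operator Kronecker

namespace Summit.QuantumFields.BalabanUV.T4Continuum.B13ReadingsDelta

open Summit.QuantumFields.BalabanUV.T4Continuum
open Summit.QuantumFields.BalabanUV.T4Continuum.B13OpDatum
open Summit.QuantumFields.BalabanUV.T4Continuum.B13Readings (SpeciesFormatBy SpeciesEntryBound)
open Summit.QuantumFields.BalabanUV.T4Continuum.B13ReadingsImage
open Summit.QuantumFields.BalabanUV.T4Continuum.DecayRateInterpolation (EntryDecay TwoLevelDecayRate)
open Summit.QuantumFields.BalabanUV.T4Continuum.CoerciveInverseTower (Coercive)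
open Literature.MathematicalPhysics.QuantumFieldTheory.Balaban1983to89
open Literature.MathematicalPhysics.QuantumFieldTheory.Balaban1983to89.B5Prop11Plancherel (Cst Cst_nonneg Tor fine)
open Literature.MathematicalPhysics.QuantumFieldTheory.Balaban1983to89.B5G183RateUnitTower (lev lev_neZero)
open Literature.MathematicalPhysics.QuantumFieldTheory.Balaban1983to89.T4EtaRateMin (LocalRate NE3Shape)
open Summit.QuantumFields.BalabanUV.T4Continuum.BalabanAveragedTowerUnit (idx Qlev)
open Summit.QuantumFields.BalabanUV.T4Continuum.BackgroundResolventTower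
open Summit.QuantumFields.BalabanUV.T4Continuum.KingPairingPlantedLaw (calDalev JpcT CJ CJ_nonneg)
open Summit.QuantumFields.BalabanUV.T4Continuum.GramPerturbationLaw (C2gram)
open Summit.QuantumFields.BalabanUV.T4Continuum.NE2FromNE3 (bgReadings)
open Summit.QuantumFields.BalabanUV.T4Continuum.NE2ColourPerturbedLayer (pertCovC)
open Summit.QuantumFields.BalabanUV.T4Continuum.NE2ColourPerturbedLayerRate (const_mul_invPow_le)
open Summit.QuantumFields.BalabanUV.T4Continuum.ColourPerturbedStations (opNorm_pertCovC_succ_sub_le)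
open Summit.QuantumFields.BalabanUV.T4Continuum.CovariantAveragingSummand (kappaQ kappaQ_ofReal)
open Summit.QuantumFields.BalabanUV.T4Continuum.RegularBackgroundTower (RegularTransporters regClass betaNE3)
open Summit.QuantumFields.BalabanUV.T4Continuum.GaugeTermScalarData (QuT Q1)
open Summit.QuantumFields.BalabanUV.T4Continuum.RegularSiteTransporters (siteT)
open Summit.QuantumFields.BalabanUV.T4Continuum.NestedContourTransport (theta0)
open Summit.QuantumFields.BalabanUV.T4Continuum.NE2BalabanRoot (balabanPert)
open Summit.QuantumFields.BalabanUV.T4Continuum.NE2BalabanGauge (gaugeSlot liftR)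
open Summit.QuantumFields.BalabanUV.T4Continuum.NE2BalabanLayerSharp (kappaBs C2Bs KstarR)
open Summit.QuantumFields.BalabanUV.T4Continuum.NE2BalabanWiring (epsR CdeltaR epsR_nonneg)
open Summit.QuantumFields.BalabanUV.T4Continuum.NE2BalabanFinal (tauR kappa4F C4F)
open Summit.QuantumFields.BalabanUV.T4Continuum.NE2BalabanThreshold (etaStar smallness_of_le)
open Summit.QuantumFields.BalabanUV.T4Continuum.NE2BalabanFinalRate (perturbationLaws_balaban_final_rate)
open Summit.QuantumFields.BalabanUV.T4Continuum.NE2FromNE3Carrier (ne2Loc)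
open Summit.QuantumFields.BalabanUV.T4Continuum.NE2BalabanFromNE3 (localRate_minActReadings_iff)
open Summit.QuantumFields.BalabanUV.T4Continuum.OutputRateTowerBalaban (norm_one_mul_kappaBs_lt_one_of_regular)
open Summit.QuantumFields.BalabanUV.T4Continuum.MinimalActionRate (minActReadings)

/-! ## §1 Bałaban's typed tier-B member of record, rate-generic: the operator-norm two-level rate and King's shape for its images -/

section Balaban

variable {d : ℕ} (L : ℕ) [NeZero L] (M : Fin d → ℕ) [hM : ∀ μ, NeZero (M μ)] (a : ℝ) (ha : 0 < a)
variable {o : Type*} [Fintype o] [DecidableEq o]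
variable {Rg : (k : ℕ) → Fin d → (Tor (fine (lev L k) M) → Matrix o o ℂ)} {α β C ρ a' η : ℝ}

/-- **THE OPERATOR-NORM TWO-LEVEL RATE OF BAŁABAN's TYPED TIER-B MEMBER AT THE PHYSICAL COUPLING, RATE-GENERIC** (`d ≥ 1`, `L⁻¹ ≤ ρ < 1`):
for site-based bond transporters `Rg` (DATA) in row B5's (3.35)-class with sizes `α, β ≤ η ≤ etaStar o d a a′`, node NE3's `LocalRate … C ρ`
(OPEN, displayed) and `a′ > 0`: `‖pertCovC (P_B Rg) 1 (k+1) − pertCovC (P_B Rg) 1 k‖ ≤ Cpert(κ_B, 2dCst, CJ, C₂^B, 0, 1)·ρ^k` — PART 4's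
`perturbationLaws_balaban_final_rate` ∘ leaf-08's ONE-STEP STATION `ColourPerturbedStations.opNorm_pertCovC_succ_sub_le` (abstract `P`, any error
sequence) ∘ `Epert_le_Cpert` with the free defects `2dCst·L^{−k}`, `CJ·L^{−k}` majorised by `·ρ^k` — the rate-generic tier-B instance of
`opNorm_pertCovC_succ_sub_le_geom`.  Model level; NE2 ∕ NE3 NOT proved; statement and constants OURS.
[cite: King1986, Lemma 4.5 (4.32)/(4.38) p.674 (scalar resolvent template)] [folklore] -/
theorem balaban_twoLevelOpRate_rate (hd : 1 ≤ d) (hreg : RegularTransporters L M (liftR L M Rg) α β) (hα : 0 ≤ α) (hβ : 0 ≤ β)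
    (hC : 0 ≤ C) (hρ : ((L : ℝ)⁻¹) ≤ ρ) (hρ1 : ρ < 1) (hNE3 : LocalRate (bgReadings L M (regClass L M (liftR L M Rg))) C ρ)
    (ha' : 0 < a') (hαη : α ≤ η) (hβη : β ≤ η) (hη : η ≤ etaStar o d a a') (k : ℕ) :
    ‖pertCovC L M a ha (balabanPert L M a (liftR L M Rg) (gaugeSlot L M Rg (QuT L M o (siteT L M Rg)) (Q1 L M o) a')) 1 (k + 1) -
        pertCovC L M a ha (balabanPert L M a (liftR L M Rg) (gaugeSlot L M Rg (QuT L M o (siteT L M Rg)) (Q1 L M o) a')) 1 k‖ ≤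
      Cpert (kappaBs o d a α β (a * (epsR o d α * (2 + epsR o d α) * Cst d a)) (kappa4F d a a' α β)) (2 * d * Cst d a) (CJ d a)
          (C2Bs o d L a α β C
            (a * C2gram (Cst d a) 1 (epsR o d α) (2 * d * Cst d a) (CJ d a) (Cst d a) (CdeltaR o d a α (theta0 d α (betaNE3 o C))))
            (C4F o d L a a' α β C)) 0 1 * ρ ^ k := by
  obtain ⟨h1, h2, -, -, -, -, -, -⟩ := smallness_of_le (o := o) (d := d) a ha.le ha' hα hβ hαη hβη hη
  have hP := perturbationLaws_balaban_final_rate L M a ha hd hreg hC hρ hρ1.le hNE3 ha' h1 h2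
  rw [kappaQ_ofReal ha.le] at hP
  have ht := norm_one_mul_kappaBs_lt_one_of_regular (o := o) (d := d) a ha.le ha' hα hβ hαη hβη hη
  have h2d : (0 : ℝ) ≤ 2 * d * Cst d a := mul_nonneg (mul_nonneg zero_le_two (Nat.cast_nonneg d)) (Cst_nonneg d a)
  refine (opNorm_pertCovC_succ_sub_le L M a ha hP ht k).trans ?_
  refine Epert_le_Cpert ht (const_mul_invPow_le L h2d hρ) (const_mul_invPow_le L (CJ_nonneg d a) hρ) (fun k => le_rfl)
    (fun k => ?_) k
  simp only [zero_mul, le_refl]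

variable {T κ ι Ω 𝒴 Bg m : Type*} [Fintype m] [DecidableEq m]

/-- [folklore] **KING's (4.38) TWO-LEVEL SHAPE FOR OPERATOR-LIPSCHITZ IMAGES OF THE MEMBER OF RECORD** (`d ≥ 1`, `L⁻¹ ≤ ρ < 1`): for a
datum-indexed family `Rg V` (`V ∈ dom`, DATA) in the (3.35)-class, node NE3's `LocalRate … C ρ` per member (OPEN), the threshold, slot-indexed
readings `Φ t` that are `Λ`-Lipschitz in operator norm on a set `S` holding every level of every member (`hS`), and ONE displayed
level-uniform decay binder `hdecΦ` on the images (the printed KIND of bound — η-uniform exponential decay of Bałaban's kernels — asserted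
by nobody): `TwoLevelDecayRate dist (k ↦ Φ t (c_k(V))) √(2B·Λ·Cpert) (δ∕2) √ρ` for every member and slot. -/
theorem balaban_image_twoLevelDecayRate_rate {dom : Set Bg} (hd : 1 ≤ d)
    {RgV : Bg → ((k : ℕ) → Fin d → (Tor (fine (lev L k) M) → Matrix o o ℂ))}
    (hreg : ∀ V ∈ dom, RegularTransporters L M (liftR L M (RgV V)) α β) (hα : 0 ≤ α) (hβ : 0 ≤ β) (hC : 0 ≤ C)
    (hρ : ((L : ℝ)⁻¹) ≤ ρ) (hρ1 : ρ < 1) (hNE3 : ∀ V ∈ dom, LocalRate (bgReadings L M (regClass L M (liftR L M (RgV V)))) C ρ)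
    (ha' : 0 < a') (hαη : α ≤ η) (hβη : β ≤ η) (hη : η ≤ etaStar o d a a')
    {S : Set (Matrix (idx L M 0 × o) (idx L M 0 × o) ℂ)} {Φ : T → Matrix (idx L M 0 × o) (idx L M 0 × o) ℂ → Matrix m m ℂ}
    {Λ : ℝ} (hΦ : ∀ t, OpLipschitzOn S (Φ t) Λ) (hΛ : 0 ≤ Λ)
    (hS : ∀ V ∈ dom, ∀ k, pertCovC L M a ha
      (balabanPert L M a (liftR L M (RgV V)) (gaugeSlot L M (RgV V) (QuT L M o (siteT L M (RgV V))) (Q1 L M o) a')) 1 k ∈ S)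
    {dist : m → m → ℝ} {B δ : ℝ}
    (hdecΦ : ∀ V ∈ dom, ∀ t k, EntryDecay dist (Φ t (pertCovC L M a ha
      (balabanPert L M a (liftR L M (RgV V)) (gaugeSlot L M (RgV V) (QuT L M o (siteT L M (RgV V))) (Q1 L M o) a')) 1 k)) B δ)
    (V : Bg) (hV : V ∈ dom) (t : T) :
    TwoLevelDecayRate dist (fun k => Φ t (pertCovC L M a ha
        (balabanPert L M a (liftR L M (RgV V)) (gaugeSlot L M (RgV V) (QuT L M o (siteT L M (RgV V))) (Q1 L M o) a')) 1 k))
      (Real.sqrt (2 * B * (Λ *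
        Cpert (kappaBs o d a α β (a * (epsR o d α * (2 + epsR o d α) * Cst d a)) (kappa4F d a a' α β)) (2 * d * Cst d a) (CJ d a)
          (C2Bs o d L a α β C
            (a * C2gram (Cst d a) 1 (epsR o d α) (2 * d * Cst d a) (CJ d a) (Cst d a) (CdeltaR o d a α (theta0 d α (betaNE3 o C))))
            (C4F o d L a a' α β C)) 0 1)))
      (δ / 2) (Real.sqrt ρ) :=
  (hΦ t).twoLevelDecayRate_image hΛ (hS V hV) ((inv_nonneg.mpr (Nat.cast_nonneg L)).trans hρ)
    (balaban_twoLevelOpRate_rate L M a ha hd (hreg V hV) hα hβ hC hρ hρ1 (hNE3 V hV) ha' hαη hβη hη) (hdecΦ V hV t)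

/-! ## §2 The species faces: `deltaKer`, `gammaConstituent`, the inverse dictionary, the twin on node NE3's carrier -/

/-- [folklore] **THE `deltaKer` SPECIES' W1 CONJUNCT OF RECORD AT BAŁABAN's TIER-B BACKGROUND, RATE-GENERIC — TWO RUNS.**  With the data of
`balaban_image_twoLevelDecayRate_rate`, suppliers READING the images `Φ t (c_k(V))` of the member `tow k g U` at levels `k` ∕ `k + 1`
(`ReadsTowerDeltaA∕B`) and a format dominating `e^{−(δ∕2)·dist}` on the `deltaKer` block:
`‖rawA.deltaKer t i j − rawB.deltaKer t i j‖ ≤ √(2B·Λ·Cpert)·(√ρ)^k·wt(.deltaKer t i j)` at every step of the window — the conjunct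
feeding `B13ReadingsLocal.speciesEntryBound_of_rates` (slot `h₂`) for this species, input rate `√ρ < 1`.  Displayed upstream binders: NE3
(OPEN), the class, the threshold, the Lipschitz readings `hΦ`∕`hS`, `hdecΦ` (printed KIND), the two readings — NOTHING of NE2 type. -/
theorem deltaKer_entryBound_balaban_rate {dom : Set Bg} (hd : 1 ≤ d)
    {RgV : Bg → ((k : ℕ) → Fin d → (Tor (fine (lev L k) M) → Matrix o o ℂ))}
    (hreg : ∀ V ∈ dom, RegularTransporters L M (liftR L M (RgV V)) α β) (hα : 0 ≤ α) (hβ : 0 ≤ β) (hC : 0 ≤ C)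
    (hρ : ((L : ℝ)⁻¹) ≤ ρ) (hρ1 : ρ < 1) (hNE3 : ∀ V ∈ dom, LocalRate (bgReadings L M (regClass L M (liftR L M (RgV V)))) C ρ)
    (ha' : 0 < a') (hαη : α ≤ η) (hβη : β ≤ η) (hη : η ≤ etaStar o d a a')
    {S : Set (Matrix (idx L M 0 × o) (idx L M 0 × o) ℂ)} {Φ : T → Matrix (idx L M 0 × o) (idx L M 0 × o) ℂ → Matrix m m ℂ}
    {Λ : ℝ} (hΦ : ∀ t, OpLipschitzOn S (Φ t) Λ) (hΛ : 0 ≤ Λ)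
    (hS : ∀ V ∈ dom, ∀ k, pertCovC L M a ha
      (balabanPert L M a (liftR L M (RgV V)) (gaugeSlot L M (RgV V) (QuT L M o (siteT L M (RgV V))) (Q1 L M o) a')) 1 k ∈ S)
    {dist : m → m → ℝ} {B δ : ℝ}
    (hdecΦ : ∀ V ∈ dom, ∀ t k, EntryDecay dist (Φ t (pertCovC L M a ha
      (balabanPert L M a (liftR L M (RgV V)) (gaugeSlot L M (RgV V) (QuT L M o (siteT L M (RgV V))) (Q1 L M o) a')) 1 k)) B δ)
    {Fk : ℕ → Format (Species T κ ι Ω 𝒴)} {σX : T → ι → m} {tow : ℕ → (ℕ → ℝ) → Bg → ↥dom}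
    {rawA rawB : (ℕ → ℝ) → Bg → ℕ → RawSpecies T κ ι Ω 𝒴} {W : Set (ℕ → ℝ)}
    (hreadA : ReadsTowerDeltaA (fun (V : ↥dom) t k => Φ t (pertCovC L M a ha
      (balabanPert L M a (liftR L M (RgV V)) (gaugeSlot L M (RgV V) (QuT L M o (siteT L M (RgV V))) (Q1 L M o) a')) 1 k))
      σX tow rawA W)
    (hreadB : ReadsTowerDeltaB (fun (V : ↥dom) t k => Φ t (pertCovC L M a ha
      (balabanPert L M a (liftR L M (RgV V)) (gaugeSlot L M (RgV V) (QuT L M o (siteT L M (RgV V))) (Q1 L M o) a')) 1 k))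
      σX tow rawB W)
    (hdom : DeltaWeightDominatesDist Fk dist σX (δ / 2)) (k : ℕ) {g : ℕ → ℝ} (hg : g ∈ W) (U : Bg) (t : T) (i j : ι) :
    ‖(rawA g U k).deltaKer t i j - (rawB g U k).deltaKer t i j‖ ≤
      Real.sqrt (2 * B * (Λ *
        Cpert (kappaBs o d a α β (a * (epsR o d α * (2 + epsR o d α) * Cst d a)) (kappa4F d a a' α β)) (2 * d * Cst d a) (CJ d a)
          (C2Bs o d L a α β C
            (a * C2gram (Cst d a) 1 (epsR o d α) (2 * d * Cst d a) (CJ d a) (Cst d a) (CdeltaR o d a α (theta0 d α (betaNE3 o C))))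
            (C4F o d L a a' α β C)) 0 1)) *
        Real.sqrt ρ ^ k * (Fk k).wt (.deltaKer t i j) :=
  deltaKer_entryBound_of_twoLevelDecayRate (Real.sqrt_nonneg _) (Real.sqrt_nonneg _)
    (fun (V : ↥dom) t => balaban_image_twoLevelDecayRate_rate L M a ha hd hreg hα hβ hC hρ hρ1 hNE3 ha' hαη hβη hη hΦ hΛ hS hdecΦ
      V.1 V.2 t)
    hreadA hreadB hdom k hg U t i j

/-- [folklore] **THE `gammaConstituent` SPECIES' W1 CONJUNCT OF RECORD AT BAŁABAN's TIER-B BACKGROUND, RATE-GENERIC — TWO RUNS** (slot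
`h₃` of `speciesEntryBound_of_rates`): as `deltaKer_entryBound_balaban_rate` with the constituent's readings `Ψ t` (its own Lipschitz
constant `Λ′`, set `S′`, decay binder) read through the two index maps `σB`, `σX`. -/
theorem gammaConstituent_entryBound_balaban_rate {dom : Set Bg} (hd : 1 ≤ d)
    {RgV : Bg → ((k : ℕ) → Fin d → (Tor (fine (lev L k) M) → Matrix o o ℂ))}
    (hreg : ∀ V ∈ dom, RegularTransporters L M (liftR L M (RgV V)) α β) (hα : 0 ≤ α) (hβ : 0 ≤ β) (hC : 0 ≤ C)
    (hρ : ((L : ℝ)⁻¹) ≤ ρ) (hρ1 : ρ < 1) (hNE3 : ∀ V ∈ dom, LocalRate (bgReadings L M (regClass L M (liftR L M (RgV V)))) C ρ)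
    (ha' : 0 < a') (hαη : α ≤ η) (hβη : β ≤ η) (hη : η ≤ etaStar o d a a')
    {S' : Set (Matrix (idx L M 0 × o) (idx L M 0 × o) ℂ)} {Ψ : T → Matrix (idx L M 0 × o) (idx L M 0 × o) ℂ → Matrix m m ℂ}
    {Λ' : ℝ} (hΨ : ∀ t, OpLipschitzOn S' (Ψ t) Λ') (hΛ' : 0 ≤ Λ')
    (hS' : ∀ V ∈ dom, ∀ k, pertCovC L M a ha
      (balabanPert L M a (liftR L M (RgV V)) (gaugeSlot L M (RgV V) (QuT L M o (siteT L M (RgV V))) (Q1 L M o) a')) 1 k ∈ S')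
    {dist : m → m → ℝ} {B' δ' : ℝ}
    (hdecΨ : ∀ V ∈ dom, ∀ t k, EntryDecay dist (Ψ t (pertCovC L M a ha
      (balabanPert L M a (liftR L M (RgV V)) (gaugeSlot L M (RgV V) (QuT L M o (siteT L M (RgV V))) (Q1 L M o) a')) 1 k)) B' δ')
    {Fk : ℕ → Format (Species T κ ι Ω 𝒴)} {σB : T → κ → m} {σX : T → ι → m} {tow : ℕ → (ℕ → ℝ) → Bg → ↥dom}
    {rawA rawB : (ℕ → ℝ) → Bg → ℕ → RawSpecies T κ ι Ω 𝒴} {W : Set (ℕ → ℝ)}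
    (hreadA : ReadsTowerGammaA (fun (V : ↥dom) t k => Ψ t (pertCovC L M a ha
      (balabanPert L M a (liftR L M (RgV V)) (gaugeSlot L M (RgV V) (QuT L M o (siteT L M (RgV V))) (Q1 L M o) a')) 1 k))
      σB σX tow rawA W)
    (hreadB : ReadsTowerGammaB (fun (V : ↥dom) t k => Ψ t (pertCovC L M a ha
      (balabanPert L M a (liftR L M (RgV V)) (gaugeSlot L M (RgV V) (QuT L M o (siteT L M (RgV V))) (Q1 L M o) a')) 1 k))
      σB σX tow rawB W)
    (hdom : GammaWeightDominatesDist Fk dist σB σX (δ' / 2)) (k : ℕ) {g : ℕ → ℝ} (hg : g ∈ W) (U : Bg) (t : T) (a'' : κ) (i : ι) :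
    ‖(rawA g U k).gammaConstituent t a'' i - (rawB g U k).gammaConstituent t a'' i‖ ≤
      Real.sqrt (2 * B' * (Λ' *
        Cpert (kappaBs o d a α β (a * (epsR o d α * (2 + epsR o d α) * Cst d a)) (kappa4F d a a' α β)) (2 * d * Cst d a) (CJ d a)
          (C2Bs o d L a α β C
            (a * C2gram (Cst d a) 1 (epsR o d α) (2 * d * Cst d a) (CJ d a) (Cst d a) (CdeltaR o d a α (theta0 d α (betaNE3 o C))))
            (C4F o d L a a' α β C)) 0 1)) *
        Real.sqrt ρ ^ k * (Fk k).wt (.gammaConstituent t a'' i) :=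
  gammaConstituent_entryBound_of_twoLevelDecayRate (Real.sqrt_nonneg _) (Real.sqrt_nonneg _)
    (fun (V : ↥dom) t => balaban_image_twoLevelDecayRate_rate L M a ha hd hreg hα hβ hC hρ hρ1 hNE3 ha' hαη hβη hη hΨ hΛ' hS' hdecΨ
      V.1 V.2 t)
    hreadA hreadB hdom k hg U t a'' i

/-- [folklore] **THE INVERSE-DICTIONARY FACE FOR `deltaKer`** (the candidate reading `A = (slot-sandwich of) c_k⁻¹`; model level): with
`Φ t = R t ∘ inverse`, `R t` `Λ`-Lipschitz everywhere (e.g. a fixed sandwich), and ONE displayed UNIFORM COERCIVITY binder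
`hco : ∀ V k, Coercive γ (c_k(V))` (`γ > 0`; a uniform LOWER bound on the covariance member = an UPPER bound on the `δ`-function operator of
the KIND of [Balaban1984PropagatorsI] (1.67) p. 29 «⟨B, Δ_kB⟩ ≦ γ₁⟨∂₁B, ∂₁B⟩» — asserted by nobody), the `deltaKer` conjunct holds with
`√(2B·(Λγ⁻²)·Cpert)·(√ρ)^k` — `deltaKer_entryBound_balaban_rate` at `S = {γ-coercive}`, `Φ t = R t ∘ (·)⁻¹` via `opLipschitzOn_inv` and
`OpLipschitzOn.comp`. -/
theorem deltaKer_entryBound_balaban_inv_rate {dom : Set Bg} (hd : 1 ≤ d)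
    {RgV : Bg → ((k : ℕ) → Fin d → (Tor (fine (lev L k) M) → Matrix o o ℂ))}
    (hreg : ∀ V ∈ dom, RegularTransporters L M (liftR L M (RgV V)) α β) (hα : 0 ≤ α) (hβ : 0 ≤ β) (hC : 0 ≤ C)
    (hρ : ((L : ℝ)⁻¹) ≤ ρ) (hρ1 : ρ < 1) (hNE3 : ∀ V ∈ dom, LocalRate (bgReadings L M (regClass L M (liftR L M (RgV V)))) C ρ)
    (ha' : 0 < a') (hαη : α ≤ η) (hβη : β ≤ η) (hη : η ≤ etaStar o d a a') {γ : ℝ} (hγ : 0 < γ)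
    (hco : ∀ V ∈ dom, ∀ k, Coercive γ (pertCovC L M a ha
      (balabanPert L M a (liftR L M (RgV V)) (gaugeSlot L M (RgV V) (QuT L M o (siteT L M (RgV V))) (Q1 L M o) a')) 1 k))
    {R : T → Matrix (idx L M 0 × o) (idx L M 0 × o) ℂ → Matrix m m ℂ} {Λ : ℝ} (hR : ∀ t, OpLipschitzOn Set.univ (R t) Λ)
    (hΛ : 0 ≤ Λ) {dist : m → m → ℝ} {B δ : ℝ}
    (hdecΦ : ∀ V ∈ dom, ∀ t k, EntryDecay dist (R t (pertCovC L M a ha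
      (balabanPert L M a (liftR L M (RgV V)) (gaugeSlot L M (RgV V) (QuT L M o (siteT L M (RgV V))) (Q1 L M o) a')) 1 k)⁻¹) B δ)
    {Fk : ℕ → Format (Species T κ ι Ω 𝒴)} {σX : T → ι → m} {tow : ℕ → (ℕ → ℝ) → Bg → ↥dom}
    {rawA rawB : (ℕ → ℝ) → Bg → ℕ → RawSpecies T κ ι Ω 𝒴} {W : Set (ℕ → ℝ)}
    (hreadA : ReadsTowerDeltaA (fun (V : ↥dom) t k => R t (pertCovC L M a ha
      (balabanPert L M a (liftR L M (RgV V)) (gaugeSlot L M (RgV V) (QuT L M o (siteT L M (RgV V))) (Q1 L M o) a')) 1 k)⁻¹)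
      σX tow rawA W)
    (hreadB : ReadsTowerDeltaB (fun (V : ↥dom) t k => R t (pertCovC L M a ha
      (balabanPert L M a (liftR L M (RgV V)) (gaugeSlot L M (RgV V) (QuT L M o (siteT L M (RgV V))) (Q1 L M o) a')) 1 k)⁻¹)
      σX tow rawB W)
    (hdom : DeltaWeightDominatesDist Fk dist σX (δ / 2)) (k : ℕ) {g : ℕ → ℝ} (hg : g ∈ W) (U : Bg) (t : T) (i j : ι) :
    ‖(rawA g U k).deltaKer t i j - (rawB g U k).deltaKer t i j‖ ≤
      Real.sqrt (2 * B * (Λ * (γ⁻¹) ^ 2 *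
        Cpert (kappaBs o d a α β (a * (epsR o d α * (2 + epsR o d α) * Cst d a)) (kappa4F d a a' α β)) (2 * d * Cst d a) (CJ d a)
          (C2Bs o d L a α β C
            (a * C2gram (Cst d a) 1 (epsR o d α) (2 * d * Cst d a) (CJ d a) (Cst d a) (CdeltaR o d a α (theta0 d α (betaNE3 o C))))
            (C4F o d L a a' α β C)) 0 1)) *
        Real.sqrt ρ ^ k * (Fk k).wt (.deltaKer t i j) :=
  deltaKer_entryBound_balaban_rate L M a ha hd hreg hα hβ hC hρ hρ1 hNE3 ha' hαη hβη hη
    (S := {X | Coercive γ X}) (Φ := fun t X => R t X⁻¹)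
    (fun t => (hR t).comp (opLipschitzOn_inv hγ) (fun _ _ => Set.mem_univ _) hΛ)
    (mul_nonneg hΛ (sq_nonneg _)) hco hdecΦ hreadA hreadB hdom k hg U t i j

/-- [folklore] **THE `deltaKer` FACE WITH THE FAMILY = THE ADMISSIBLE DATA OF NODE NE3's CARRIER AND NODE U1b's FULL SHAPE** (ONE binder
`NE3Shape (minActReadings …) C θ`, honest rate `0 ≤ θ < 1`): the conjunct at the input rate `√(max θ L⁻¹) < 1` (the constant `√(2B·Λ·Cpert)` is
rate-free).  No rate binder and no binder of NE2 type is displayed.  (The `gammaConstituent` twin is the same substitution.) -/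
theorem deltaKer_entryBound_balaban_ne3Shape {𝒞 : ℕ → Set (B7Prop1Explicit.Site d → Fin d → (Matrix o o ℂ)ˣ)} {N : ℕ}
    {dom : Set (B7Prop1Explicit.Site d → Fin d → (Matrix o o ℂ)ˣ)} (hL : 2 ≤ L) (hd : 1 ≤ d)
    {RgV : (B7Prop1Explicit.Site d → Fin d → (Matrix o o ℂ)ˣ) → ((k : ℕ) → Fin d → (Tor (fine (lev L k) M) → Matrix o o ℂ))}
    (hreg : ∀ V ∈ dom, RegularTransporters L M (liftR L M (RgV V)) α β) (hα : 0 ≤ α) (hβ : 0 ≤ β) (hC : 0 ≤ C) {θ : ℝ}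
    (hNE3 : NE3Shape (minActReadings d 𝒞 L N dom (ne2Loc L M fun V => liftR L M (RgV V))) C θ)
    (ha' : 0 < a') (hαη : α ≤ η) (hβη : β ≤ η) (hη : η ≤ etaStar o d a a')
    {S : Set (Matrix (idx L M 0 × o) (idx L M 0 × o) ℂ)} {Φ : T → Matrix (idx L M 0 × o) (idx L M 0 × o) ℂ → Matrix m m ℂ}
    {Λ : ℝ} (hΦ : ∀ t, OpLipschitzOn S (Φ t) Λ) (hΛ : 0 ≤ Λ)
    (hS : ∀ V ∈ dom, ∀ k, pertCovC L M a ha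
      (balabanPert L M a (liftR L M (RgV V)) (gaugeSlot L M (RgV V) (QuT L M o (siteT L M (RgV V))) (Q1 L M o) a')) 1 k ∈ S)
    {dist : m → m → ℝ} {B δ : ℝ}
    (hdecΦ : ∀ V ∈ dom, ∀ t k, EntryDecay dist (Φ t (pertCovC L M a ha
      (balabanPert L M a (liftR L M (RgV V)) (gaugeSlot L M (RgV V) (QuT L M o (siteT L M (RgV V))) (Q1 L M o) a')) 1 k)) B δ)
    {Fk : ℕ → Format (Species T κ ι Ω 𝒴)} {σX : T → ι → m}
    {tow : ℕ → (ℕ → ℝ) → (B7Prop1Explicit.Site d → Fin d → (Matrix o o ℂ)ˣ) → ↥dom}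
    {rawA rawB : (ℕ → ℝ) → (B7Prop1Explicit.Site d → Fin d → (Matrix o o ℂ)ˣ) → ℕ → RawSpecies T κ ι Ω 𝒴} {W : Set (ℕ → ℝ)}
    (hreadA : ReadsTowerDeltaA (fun (V : ↥dom) t k => Φ t (pertCovC L M a ha
      (balabanPert L M a (liftR L M (RgV V)) (gaugeSlot L M (RgV V) (QuT L M o (siteT L M (RgV V))) (Q1 L M o) a')) 1 k))
      σX tow rawA W)
    (hreadB : ReadsTowerDeltaB (fun (V : ↥dom) t k => Φ t (pertCovC L M a ha
      (balabanPert L M a (liftR L M (RgV V)) (gaugeSlot L M (RgV V) (QuT L M o (siteT L M (RgV V))) (Q1 L M o) a')) 1 k))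
      σX tow rawB W)
    (hdom : DeltaWeightDominatesDist Fk dist σX (δ / 2)) (k : ℕ) {g : ℕ → ℝ} (hg : g ∈ W)
    (U : B7Prop1Explicit.Site d → Fin d → (Matrix o o ℂ)ˣ) (t : T) (i j : ι) :
    ‖(rawA g U k).deltaKer t i j - (rawB g U k).deltaKer t i j‖ ≤
      Real.sqrt (2 * B * (Λ *
        Cpert (kappaBs o d a α β (a * (epsR o d α * (2 + epsR o d α) * Cst d a)) (kappa4F d a a' α β)) (2 * d * Cst d a) (CJ d a)
          (C2Bs o d L a α β C
            (a * C2gram (Cst d a) 1 (epsR o d α) (2 * d * Cst d a) (CJ d a) (Cst d a) (CdeltaR o d a α (theta0 d α (betaNE3 o C))))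
            (C4F o d L a a' α β C)) 0 1)) *
        Real.sqrt (max θ ((L : ℝ)⁻¹)) ^ k * (Fk k).wt (.deltaKer t i j) := by
  have hlt : max θ ((L : ℝ)⁻¹) < 1 :=
    max_lt hNE3.rate_lt_one (inv_lt_one_of_one_lt₀ (by exact_mod_cast (lt_of_lt_of_le one_lt_two hL : 1 < L)))
  exact deltaKer_entryBound_balaban_rate L M a ha hd hreg hα hβ hC (le_max_right _ _) hlt
    (fun V hV => ((localRate_minActReadings_iff L M).1 hNE3.pointwise V hV).mono le_rfl hNE3.rate_nonneg (le_max_left _ _) hC)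
    ha' hαη hβη hη hΦ hΛ hS hdecΦ hreadA hreadB hdom k hg U t i j

end Balaban

end Summit.QuantumFields.BalabanUV.T4Continuum.B13ReadingsDelta

end
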